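import Mathlib
import HarnessLib
import Summits.NavierStokesRegularity.NavierStokesRegularity.Theorems.PoloidalWindowDoorLrcModEntireJetCertGaugeVCancel
import Summits.NavierStokesRegularity.NavierStokesRegularity.Theorems.PoloidalWindowDoorLrcModEntireTHCertGaugeRS
import Summits.NavierStokesRegularity.NavierStokesRegularity.Theorems.PoloidalWindowDoorLrcModEntireTHCertSliceUD8T

/-!
# Route `PoloidalWindowDoor`, item `LrcModEntire` (stmt-NavierStokesRegularity-20428) — the GAUGED (TH) data in the unsteady slice letters WITH TIME JETS
# (`…THCertSliceUD8T`): Galilean zeros / RS zeros + value, and the registered stub `stub_localTHEmptyHypNUGRS` BY NAME from one gauged leaf or one split-free chain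

Cell ns-regularity-ideate, seat ns-k2-port-2 g2 (kernel-port lineage under the LEAD of item 20428, ns-poloidal-K2-p3 g11; `--supports stmt-NavierStokesRegularity-20428`).
Mirror of `…THCertSliceGaugeUD8` (K2-p3 g8) and `…THCertSliceGaugeUD8RS` / `…UD8RSChain` (port-2 g0) over the time-extended dictionary `…THCertSliceUD8TData.sliceRelabel`
(264 letters; indices 0–188 = UD8's).  The gauge letters are the SAME indices as in UD8 (the prefix is unchanged): Galilean point-zero letters `[Rw_0_0, Rf_1_0, If_1_0]`
= `[0, 45, 46]`; RS gauge adds the zero `Rw_1_0` (index `1`) and the point VALUE `Iw_1_0 = −1/2` (index `2`).  NO gauge condition is imposed on any time-jet letter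
(`Rwt_0_0`, `Rft_1_0`, … are free at `p₀`): this is the INERTIAL frame — the co-moving normalisation `u(t, X(t)) ≡ 0` of DYNAMIC-ROWS-g11 §2 is not available in the
tree (it needs the analytic particle path), so engine certificates that use it do not check here; produce them with `wt₀₀, ft₁₀, ft₀₁, wtt₀₀, …` kept as free letters.

* `sliceGaugeZeros = [0, 45, 46]`, `sliceGaugeZerosRS = [0, 45, 46, 1]`, `sliceGaugeValsRS = [(2, −1/2)]` and their transfer checks (`decide` / `decide +kernel`);
* `thSliceLocalDatumZ` (Galilean rest point) and `thSliceLocalDatumZV` (RS normal form) — from the hypotheses of the registered stub (sign unused);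
* `localTHEmptyHypNUGRS_of_sliceLeafZ` — **the registered v4.3/v5 text VERBATIM from ONE Galilean-gauged leaf** (`leafCheckZ`; the RS hypotheses are simply not used:
  an EMPTY found without the rotation–scaling gauge closes the RS statement a fortiori);
* `localTHEmptyHypNUGRS_of_sliceLeafZV` — the same from ONE RS-gauged leaf (`leafCheckZV`: substitute `Iw_1_0 ↦ −1/2`, then every remaining term of
  `law_k − pins^e` contains a zero letter);
* `localTHEmptyHypNUGRS_of_sliceChainZ` / `…_of_sliceChainZV` — the same from ONE split-free gauged CHAIN (chunks + cancellations + gauged leaf;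
  `…JetCertGaugeCancel.gaugedChainCheck` / `…JetCertGaugeVCancel.gaugedChainCheckV`), the format of KERNEL-CERT-FORMAT-g8 §4 / KERNEL-CERT-FORMAT-RS.

WHAT THIS IS NOT: not a claim about Navier–Stokes and not a certificate — plumbing; no leaf/chain with a `true` check is known. [folklore]
-/

noncomputable section

set_option maxRecDepth 100000

-- the summit and its single sub-problem share the name (CONVENTIONS §1), as in every Theorems file
set_option linter.dupNamespace false

namespace Summit.NavierStokesRegularity.NavierStokesRegularity.Theorems.PoloidalWindowDoorLrcModEntireTHCertSliceGaugeUD8T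

open _root_.Topology _root_.Filter Set Function
open scoped InnerProductSpace Laplacian
open Literature.Analysis.ValidatedNumerics
open Summit.NavierStokesRegularity.NavierStokesRegularity.Theorems.PoloidalWindowDoorLrcModEntireJetCertDefs
open Summit.NavierStokesRegularity.NavierStokesRegularity.Theorems.PoloidalWindowDoorLrcModEntireJetCertTree
open Summit.NavierStokesRegularity.NavierStokesRegularity.Theorems.PoloidalWindowDoorLrcModEntireJetCertFast2
open Summit.NavierStokesRegularity.NavierStokesRegularity.Theorems.PoloidalWindowDoorLrcModEntireJetCertRelabel
open Summit.NavierStokesRegularity.NavierStokesRegularity.Theorems.PoloidalWindowDoorLrcModEntireJetCertGauge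
open Summit.NavierStokesRegularity.NavierStokesRegularity.Theorems.PoloidalWindowDoorLrcModEntireJetCertGaugeV
open Summit.NavierStokesRegularity.NavierStokesRegularity.Theorems.PoloidalWindowDoorLrcModEntireJetCertGaugeCancel
open Summit.NavierStokesRegularity.NavierStokesRegularity.Theorems.PoloidalWindowDoorLrcModEntireJetCertGaugeVCancel
open Summit.NavierStokesRegularity.NavierStokesRegularity.Theorems.PoloidalWindowDoorLrcModEntireTHCertLetters
open Summit.NavierStokesRegularity.NavierStokesRegularity.Theorems.PoloidalWindowDoorLrcModEntireTHCert
open Summit.NavierStokesRegularity.NavierStokesRegularity.Theorems.PoloidalWindowDoorLrcModEntireTHCertSteady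
open Summit.NavierStokesRegularity.NavierStokesRegularity.Theorems.PoloidalWindowDoorLrcModEntireTHCertGauge
open Summit.NavierStokesRegularity.NavierStokesRegularity.Theorems.PoloidalWindowDoorLrcModEntireTHCertGaugeRS
open Summit.NavierStokesRegularity.NavierStokesRegularity.Theorems.PoloidalWindowDoorLrcModEntireTHCertSliceUD8TData
open Summit.NavierStokesRegularity.NavierStokesRegularity.Theorems.PoloidalWindowDoorLrcModEntireTHCertSliceUD8T

/-! ### Gauge letters and their transfer checks -/

/-- The point-zero letters of the Galilean gauge: indices of `Rw_0_0, Rf_1_0, If_1_0` (as in `…THCertSliceGaugeUD8`). [folklore] -/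
def sliceGaugeZeros : List ℕ := [0, 45, 46]

/-- The point-zero letters of the RS gauge: indices of `Rw_0_0, Rf_1_0, If_1_0, Rw_1_0` (as in `…THCertSliceGaugeUD8RS`). [folklore] -/
def sliceGaugeZerosRS : List ℕ := [0, 45, 46, 1]

/-- The point-value letter of the RS gauge: `Iw_1_0 = −1/2` (index `2`). [folklore] -/
def sliceGaugeValsRS : List (ℕ × ℚ) := [(2, -1/2)]

/-- Galilean zero-letter transfer: each is a multiple of a Cartesian gauge letter (`u₂, u₀/2, −u₁/2`). [folklore] -/
theorem sliceZeros_check : zerosCheck sliceLetters.length sliceRelabel (gaugeZeros sliceLetters) sliceGaugeZeros = true := by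
  decide

/-- RS zero-letter transfer (`u₂, u₀/2, −u₁/2, ∂₀u₂/2`). [folklore] -/
theorem sliceZerosRS_check :
    zerosCheck sliceLetters.length sliceRelabel (gaugeZerosRS sliceLetters) sliceGaugeZerosRS = true := by
  decide

/-- RS value-letter transfer: `Iw_1_0 = −∂₁u₂/2` takes the value `−1/2` at `p₀` when `∂₁u₂(p₀) = 1`. [folklore] -/
theorem sliceValsRS_check :
    valsCheckD sliceLetters.length sliceRelabel (gaugeZerosRS sliceLetters) (gaugeValsRS sliceLetters) sliceGaugeValsRS = true := by
  decide +kernel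

/-! ### The gauged data -/

/-- **THE GALILEAN-GAUGED (TH) DATUM IN THE TIME-EXTENDED SLICE LETTERS**, from the hypotheses of the registered stub (sign and RS normal form unused). [folklore] -/
theorem thSliceLocalDatumZ
    {u : ℝ → EuclideanSpace ℝ (Fin 3) → EuclideanSpace ℝ (Fin 3)} {μ A : ℝ → ℝ → ℝ}
    {U : Set (ℝ × EuclideanSpace ℝ (Fin 3))} {p₀ : ℝ × EuclideanSpace ℝ (Fin 3)} (hU : IsOpen U) (hp₀ : p₀ ∈ U)
    (hu : AnalyticOnNhd ℝ (Function.uncurry u) U)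
    (hμ : ∀ p ∈ U, AnalyticAt ℝ (Function.uncurry μ) (p.1, p.2 2)) (hA : ∀ p ∈ U, AnalyticAt ℝ (Function.uncurry A) (p.1, p.2 2))
    (hpol : ∀ p ∈ U, fderiv ℝ (u p.1) p.2 (EuclideanSpace.single 0 1) 1 = fderiv ℝ (u p.1) p.2 (EuclideanSpace.single 1 1) 0)
    (hdiv : ∀ p ∈ U, fderiv ℝ (u p.1) p.2 (EuclideanSpace.single 0 1) 0 + fderiv ℝ (u p.1) p.2 (EuclideanSpace.single 1 1) 1 +
      fderiv ℝ (u p.1) p.2 (EuclideanSpace.single 2 1) 2 = 0)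
    (hsh : ∀ p ∈ U, ∀ b : Fin 3, b ≠ 2 →
      fderiv ℝ (u p.1) p.2 (EuclideanSpace.single 2 1) b = μ p.1 (p.2 2) * fderiv ℝ (u p.1) p.2 (EuclideanSpace.single b 1) 2)
    (hE : ∀ p ∈ U,
      (1 - μ p.1 (p.2 2)) *
          (deriv (fun s => u s p.2 2) p.1 + fderiv ℝ (fun y => u p.1 y 2) p.2 (u p.1 p.2) - Δ (fun y => u p.1 y 2) p.2) =
        A p.1 (p.2 2) + (deriv (fun s => μ s (p.2 2)) p.1 - deriv (deriv (μ p.1)) (p.2 2)) * u p.1 p.2 2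
          + deriv (μ p.1) (p.2 2) / 2 * u p.1 p.2 2 ^ 2 - 2 * deriv (μ p.1) (p.2 2) * fderiv ℝ (u p.1) p.2 (EuclideanSpace.single 2 1) 2)
    (htw : fderiv ℝ (fun y => fderiv ℝ (u p₀.1) y (EuclideanSpace.single 2 1) 2) p₀.2 (EuclideanSpace.single 0 1) *
            fderiv ℝ (u p₀.1) p₀.2 (EuclideanSpace.single 1 1) 2 -
          fderiv ℝ (fun y => fderiv ℝ (u p₀.1) y (EuclideanSpace.single 2 1) 2) p₀.2 (EuclideanSpace.single 1 1) *
            fderiv ℝ (u p₀.1) p₀.2 (EuclideanSpace.single 0 1) 2 ≠ 0)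
    (hm0 : μ p₀.1 (p₀.2 2) ≠ 0) (hm1 : μ p₀.1 (p₀.2 2) ≠ 1) (hmz : deriv (μ p₀.1) (p₀.2 2) ≠ 0)
    (hNU : fderiv ℝ (u p₀.1) p₀.2 (EuclideanSpace.single 0 1) 0 ≠ fderiv ℝ (u p₀.1) p₀.2 (EuclideanSpace.single 1 1) 1 ∨
      fderiv ℝ (u p₀.1) p₀.2 (EuclideanSpace.single 1 1) 0 ≠ 0)
    (hrest : u p₀.1 p₀.2 = 0) :
    LocalDatumZ (E := ℝ × EuclideanSpace ℝ (Fin 3)) sliceRelabel.m sliceRelabel.Sf sliceRelabel.Mf dirVec sliceRelabel.hyps' sliceRelabel.pins'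
      sliceGaugeZeros :=
  LocalDatumZ.relabel sliceRelabel sliceGaugeZeros sliceRelabel_check sliceZeros_check
    (thLocalDatumZ sliceLetters sliceLetters_ok hU hp₀ hu hμ hA hpol hdiv hsh hE htw hm0 hm1 hmz hNU hrest)

/-- **THE RS-GAUGED (TH) DATUM IN THE TIME-EXTENDED SLICE LETTERS**, from the hypotheses of the registered v4.3/v5 stub (the sign `μ(p₀) < 0` unused). [folklore] -/
theorem thSliceLocalDatumZV
    {u : ℝ → EuclideanSpace ℝ (Fin 3) → EuclideanSpace ℝ (Fin 3)} {μ A : ℝ → ℝ → ℝ}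
    {U : Set (ℝ × EuclideanSpace ℝ (Fin 3))} {p₀ : ℝ × EuclideanSpace ℝ (Fin 3)} (hU : IsOpen U) (hp₀ : p₀ ∈ U)
    (hu : AnalyticOnNhd ℝ (Function.uncurry u) U)
    (hμ : ∀ p ∈ U, AnalyticAt ℝ (Function.uncurry μ) (p.1, p.2 2)) (hA : ∀ p ∈ U, AnalyticAt ℝ (Function.uncurry A) (p.1, p.2 2))
    (hpol : ∀ p ∈ U, fderiv ℝ (u p.1) p.2 (EuclideanSpace.single 0 1) 1 = fderiv ℝ (u p.1) p.2 (EuclideanSpace.single 1 1) 0)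
    (hdiv : ∀ p ∈ U, fderiv ℝ (u p.1) p.2 (EuclideanSpace.single 0 1) 0 + fderiv ℝ (u p.1) p.2 (EuclideanSpace.single 1 1) 1 +
      fderiv ℝ (u p.1) p.2 (EuclideanSpace.single 2 1) 2 = 0)
    (hsh : ∀ p ∈ U, ∀ b : Fin 3, b ≠ 2 →
      fderiv ℝ (u p.1) p.2 (EuclideanSpace.single 2 1) b = μ p.1 (p.2 2) * fderiv ℝ (u p.1) p.2 (EuclideanSpace.single b 1) 2)
    (hE : ∀ p ∈ U,
      (1 - μ p.1 (p.2 2)) *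
          (deriv (fun s => u s p.2 2) p.1 + fderiv ℝ (fun y => u p.1 y 2) p.2 (u p.1 p.2) - Δ (fun y => u p.1 y 2) p.2) =
        A p.1 (p.2 2) + (deriv (fun s => μ s (p.2 2)) p.1 - deriv (deriv (μ p.1)) (p.2 2)) * u p.1 p.2 2
          + deriv (μ p.1) (p.2 2) / 2 * u p.1 p.2 2 ^ 2 - 2 * deriv (μ p.1) (p.2 2) * fderiv ℝ (u p.1) p.2 (EuclideanSpace.single 2 1) 2)
    (htw : fderiv ℝ (fun y => fderiv ℝ (u p₀.1) y (EuclideanSpace.single 2 1) 2) p₀.2 (EuclideanSpace.single 0 1) *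
            fderiv ℝ (u p₀.1) p₀.2 (EuclideanSpace.single 1 1) 2 -
          fderiv ℝ (fun y => fderiv ℝ (u p₀.1) y (EuclideanSpace.single 2 1) 2) p₀.2 (EuclideanSpace.single 1 1) *
            fderiv ℝ (u p₀.1) p₀.2 (EuclideanSpace.single 0 1) 2 ≠ 0)
    (hm0 : μ p₀.1 (p₀.2 2) ≠ 0) (hm1 : μ p₀.1 (p₀.2 2) ≠ 1) (hmz : deriv (μ p₀.1) (p₀.2 2) ≠ 0)
    (hNU : fderiv ℝ (u p₀.1) p₀.2 (EuclideanSpace.single 0 1) 0 ≠ fderiv ℝ (u p₀.1) p₀.2 (EuclideanSpace.single 1 1) 1 ∨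
      fderiv ℝ (u p₀.1) p₀.2 (EuclideanSpace.single 1 1) 0 ≠ 0)
    (hrest : u p₀.1 p₀.2 = 0)
    (hx0 : fderiv ℝ (u p₀.1) p₀.2 (EuclideanSpace.single 0 1) 2 = 0)
    (hy1 : fderiv ℝ (u p₀.1) p₀.2 (EuclideanSpace.single 1 1) 2 = 1) :
    LocalDatumZV (E := ℝ × EuclideanSpace ℝ (Fin 3)) sliceRelabel.m sliceRelabel.Sf sliceRelabel.Mf dirVec sliceRelabel.hyps' sliceRelabel.pins'
      sliceGaugeZerosRS sliceGaugeValsRS :=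
  LocalDatumZV.relabelD sliceRelabel sliceGaugeZerosRS sliceGaugeValsRS sliceRelabel_check sliceZerosRS_check sliceValsRS_check
    (thLocalDatumZV sliceLetters sliceLetters_ok hU hp₀ hu hμ hA hpol hdiv hsh hE htw hm0 hm1 hmz hNU hrest hx0 hy1)

/-! ### The registered stub by name -/

/-- **THE REGISTERED STUB `stub_localTHEmptyHypNUGRS` (twist_split v4.3/v5, VERBATIM) FROM ONE GALILEAN-GAUGED LEAF in the time-extended slice letters**:
a derivation `steps` from the single slice law `E'` whose law `k` equals `twist^e₀·μ^e₁·(μ−1)^e₂·μ_z^e₃·Π_NU^e₄` up to terms containing `Rw_0_0`, `Rf_1_0` or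
`If_1_0` (the rotation–scaling hypotheses are not used). [folklore] -/
theorem localTHEmptyHypNUGRS_of_sliceLeafZ (steps : List (List (QMvPoly × ℕ × List ℕ))) (k : ℕ) (e : List ℕ)
    (hcheck : leafCheckZ sliceRelabel.m sliceRelabel.Sf sliceRelabel.Mf sliceRelabel.hyps' sliceRelabel.pins' sliceGaugeZeros steps k e = true) :
    ∀ (u : ℝ → EuclideanSpace ℝ (Fin 3) → EuclideanSpace ℝ (Fin 3)) (μ A : ℝ → ℝ → ℝ)
      (U : Set (ℝ × EuclideanSpace ℝ (Fin 3))) (p₀ : ℝ × EuclideanSpace ℝ (Fin 3)),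
      IsOpen U → p₀ ∈ U →
      AnalyticOnNhd ℝ (Function.uncurry u) U →
      (∀ p ∈ U, AnalyticAt ℝ (Function.uncurry μ) (p.1, p.2 2)) →
      (∀ p ∈ U, AnalyticAt ℝ (Function.uncurry A) (p.1, p.2 2)) →
      (∀ p ∈ U, fderiv ℝ (u p.1) p.2 (EuclideanSpace.single 0 1) 1 = fderiv ℝ (u p.1) p.2 (EuclideanSpace.single 1 1) 0) →
      (∀ p ∈ U, fderiv ℝ (u p.1) p.2 (EuclideanSpace.single 0 1) 0 + fderiv ℝ (u p.1) p.2 (EuclideanSpace.single 1 1) 1 +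
        fderiv ℝ (u p.1) p.2 (EuclideanSpace.single 2 1) 2 = 0) →
      (∀ p ∈ U, ∀ b : Fin 3, b ≠ 2 →
        fderiv ℝ (u p.1) p.2 (EuclideanSpace.single 2 1) b =
          μ p.1 (p.2 2) * fderiv ℝ (u p.1) p.2 (EuclideanSpace.single b 1) 2) →
      (∀ p ∈ U,
        (1 - μ p.1 (p.2 2)) *
            (deriv (fun s => u s p.2 2) p.1 + fderiv ℝ (fun y => u p.1 y 2) p.2 (u p.1 p.2)
              - Δ (fun y => u p.1 y 2) p.2) =
          A p.1 (p.2 2) + (deriv (fun s => μ s (p.2 2)) p.1 - deriv (deriv (μ p.1)) (p.2 2)) * u p.1 p.2 2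
            + deriv (μ p.1) (p.2 2) / 2 * u p.1 p.2 2 ^ 2
            - 2 * deriv (μ p.1) (p.2 2) * fderiv ℝ (u p.1) p.2 (EuclideanSpace.single 2 1) 2) →
      fderiv ℝ (fun y => fderiv ℝ (u p₀.1) y (EuclideanSpace.single 2 1) 2) p₀.2 (EuclideanSpace.single 0 1) *
            fderiv ℝ (u p₀.1) p₀.2 (EuclideanSpace.single 1 1) 2 -
          fderiv ℝ (fun y => fderiv ℝ (u p₀.1) y (EuclideanSpace.single 2 1) 2) p₀.2 (EuclideanSpace.single 1 1) *
            fderiv ℝ (u p₀.1) p₀.2 (EuclideanSpace.single 0 1) 2 ≠ 0 →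
      μ p₀.1 (p₀.2 2) ≠ 0 → μ p₀.1 (p₀.2 2) ≠ 1 → deriv (μ p₀.1) (p₀.2 2) ≠ 0 →
      μ p₀.1 (p₀.2 2) < 0 →
      (fderiv ℝ (u p₀.1) p₀.2 (EuclideanSpace.single 0 1) 0 ≠ fderiv ℝ (u p₀.1) p₀.2 (EuclideanSpace.single 1 1) 1 ∨
        fderiv ℝ (u p₀.1) p₀.2 (EuclideanSpace.single 1 1) 0 ≠ 0) →
      u p₀.1 p₀.2 = 0 →
      fderiv ℝ (u p₀.1) p₀.2 (EuclideanSpace.single 0 1) 2 = 0 →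
      fderiv ℝ (u p₀.1) p₀.2 (EuclideanSpace.single 1 1) 2 = 1 → False := by
  intro u μ A U p₀ hU hp₀ hu hμ hA hpol hdiv hsh hE htw hm0 hm1 hmz _hneg hNU hrest _hx0 _hy1
  exact LocalDatumZ.false_of_leaf (thSliceLocalDatumZ hU hp₀ hu hμ hA hpol hdiv hsh hE htw hm0 hm1 hmz hNU hrest) hcheck

/-- **THE REGISTERED STUB `stub_localTHEmptyHypNUGRS` (VERBATIM) FROM ONE RS-GAUGED LEAF in the time-extended slice letters** (`leafCheckZV`: law `k` of the
derivation `steps` from `E'` equals `twist^e₀·μ^e₁·(μ−1)^e₂·μ_z^e₃·Π_NU^e₄` modulo ⟨Rw_0_0, Rf_1_0, If_1_0, Rw_1_0, Iw_1_0 + 1/2⟩). [folklore] -/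
theorem localTHEmptyHypNUGRS_of_sliceLeafZV (steps : List (List (QMvPoly × ℕ × List ℕ))) (k : ℕ) (e : List ℕ)
    (hcheck : leafCheckZV sliceRelabel.m sliceRelabel.Sf sliceRelabel.Mf sliceRelabel.hyps' sliceRelabel.pins' sliceGaugeZerosRS sliceGaugeValsRS
      steps k e = true) :
    ∀ (u : ℝ → EuclideanSpace ℝ (Fin 3) → EuclideanSpace ℝ (Fin 3)) (μ A : ℝ → ℝ → ℝ)
      (U : Set (ℝ × EuclideanSpace ℝ (Fin 3))) (p₀ : ℝ × EuclideanSpace ℝ (Fin 3)),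
      IsOpen U → p₀ ∈ U →
      AnalyticOnNhd ℝ (Function.uncurry u) U →
      (∀ p ∈ U, AnalyticAt ℝ (Function.uncurry μ) (p.1, p.2 2)) →
      (∀ p ∈ U, AnalyticAt ℝ (Function.uncurry A) (p.1, p.2 2)) →
      (∀ p ∈ U, fderiv ℝ (u p.1) p.2 (EuclideanSpace.single 0 1) 1 = fderiv ℝ (u p.1) p.2 (EuclideanSpace.single 1 1) 0) →
      (∀ p ∈ U, fderiv ℝ (u p.1) p.2 (EuclideanSpace.single 0 1) 0 + fderiv ℝ (u p.1) p.2 (EuclideanSpace.single 1 1) 1 +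
        fderiv ℝ (u p.1) p.2 (EuclideanSpace.single 2 1) 2 = 0) →
      (∀ p ∈ U, ∀ b : Fin 3, b ≠ 2 →
        fderiv ℝ (u p.1) p.2 (EuclideanSpace.single 2 1) b =
          μ p.1 (p.2 2) * fderiv ℝ (u p.1) p.2 (EuclideanSpace.single b 1) 2) →
      (∀ p ∈ U,
        (1 - μ p.1 (p.2 2)) *
            (deriv (fun s => u s p.2 2) p.1 + fderiv ℝ (fun y => u p.1 y 2) p.2 (u p.1 p.2)
              - Δ (fun y => u p.1 y 2) p.2) =
          A p.1 (p.2 2) + (deriv (fun s => μ s (p.2 2)) p.1 - deriv (deriv (μ p.1)) (p.2 2)) * u p.1 p.2 2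
            + deriv (μ p.1) (p.2 2) / 2 * u p.1 p.2 2 ^ 2
            - 2 * deriv (μ p.1) (p.2 2) * fderiv ℝ (u p.1) p.2 (EuclideanSpace.single 2 1) 2) →
      fderiv ℝ (fun y => fderiv ℝ (u p₀.1) y (EuclideanSpace.single 2 1) 2) p₀.2 (EuclideanSpace.single 0 1) *
            fderiv ℝ (u p₀.1) p₀.2 (EuclideanSpace.single 1 1) 2 -
          fderiv ℝ (fun y => fderiv ℝ (u p₀.1) y (EuclideanSpace.single 2 1) 2) p₀.2 (EuclideanSpace.single 1 1) *
            fderiv ℝ (u p₀.1) p₀.2 (EuclideanSpace.single 0 1) 2 ≠ 0 →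
      μ p₀.1 (p₀.2 2) ≠ 0 → μ p₀.1 (p₀.2 2) ≠ 1 → deriv (μ p₀.1) (p₀.2 2) ≠ 0 →
      μ p₀.1 (p₀.2 2) < 0 →
      (fderiv ℝ (u p₀.1) p₀.2 (EuclideanSpace.single 0 1) 0 ≠ fderiv ℝ (u p₀.1) p₀.2 (EuclideanSpace.single 1 1) 1 ∨
        fderiv ℝ (u p₀.1) p₀.2 (EuclideanSpace.single 1 1) 0 ≠ 0) →
      u p₀.1 p₀.2 = 0 →
      fderiv ℝ (u p₀.1) p₀.2 (EuclideanSpace.single 0 1) 2 = 0 →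
      fderiv ℝ (u p₀.1) p₀.2 (EuclideanSpace.single 1 1) 2 = 1 → False := by
  intro u μ A U p₀ hU hp₀ hu hμ hA hpol hdiv hsh hE htw hm0 hm1 hmz _hneg hNU hrest hx0 hy1
  exact LocalDatumZV.false_of_leaf (thSliceLocalDatumZV hU hp₀ hu hμ hA hpol hdiv hsh hE htw hm0 hm1 hmz hNU hrest hx0 hy1) hcheck

/-- **THE REGISTERED STUB `stub_localTHEmptyHypNUGRS` (VERBATIM) FROM ONE SPLIT-FREE GALILEAN-GAUGED CHAIN** (items = chunks / cancellations certified against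
`E'` extended by the earlier items' laws — e.g. static rows and their time derivatives along direction `0` — then the gauged leaf). [folklore] -/
theorem localTHEmptyHypNUGRS_of_sliceChainZ (items : List ChainItem) (steps : List (List (QMvPoly × ℕ × List ℕ))) (k : ℕ) (e : List ℕ)
    (hcheck : gaugedChainCheck sliceRelabel.m sliceRelabel.Sf sliceRelabel.Mf sliceRelabel.pins' sliceGaugeZeros
      sliceRelabel.hyps' items steps k e = true) :
    ∀ (u : ℝ → EuclideanSpace ℝ (Fin 3) → EuclideanSpace ℝ (Fin 3)) (μ A : ℝ → ℝ → ℝ)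
      (U : Set (ℝ × EuclideanSpace ℝ (Fin 3))) (p₀ : ℝ × EuclideanSpace ℝ (Fin 3)),
      IsOpen U → p₀ ∈ U →
      AnalyticOnNhd ℝ (Function.uncurry u) U →
      (∀ p ∈ U, AnalyticAt ℝ (Function.uncurry μ) (p.1, p.2 2)) →
      (∀ p ∈ U, AnalyticAt ℝ (Function.uncurry A) (p.1, p.2 2)) →
      (∀ p ∈ U, fderiv ℝ (u p.1) p.2 (EuclideanSpace.single 0 1) 1 = fderiv ℝ (u p.1) p.2 (EuclideanSpace.single 1 1) 0) →
      (∀ p ∈ U, fderiv ℝ (u p.1) p.2 (EuclideanSpace.single 0 1) 0 + fderiv ℝ (u p.1) p.2 (EuclideanSpace.single 1 1) 1 +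
        fderiv ℝ (u p.1) p.2 (EuclideanSpace.single 2 1) 2 = 0) →
      (∀ p ∈ U, ∀ b : Fin 3, b ≠ 2 →
        fderiv ℝ (u p.1) p.2 (EuclideanSpace.single 2 1) b =
          μ p.1 (p.2 2) * fderiv ℝ (u p.1) p.2 (EuclideanSpace.single b 1) 2) →
      (∀ p ∈ U,
        (1 - μ p.1 (p.2 2)) *
            (deriv (fun s => u s p.2 2) p.1 + fderiv ℝ (fun y => u p.1 y 2) p.2 (u p.1 p.2)
              - Δ (fun y => u p.1 y 2) p.2) =
          A p.1 (p.2 2) + (deriv (fun s => μ s (p.2 2)) p.1 - deriv (deriv (μ p.1)) (p.2 2)) * u p.1 p.2 2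
            + deriv (μ p.1) (p.2 2) / 2 * u p.1 p.2 2 ^ 2
            - 2 * deriv (μ p.1) (p.2 2) * fderiv ℝ (u p.1) p.2 (EuclideanSpace.single 2 1) 2) →
      fderiv ℝ (fun y => fderiv ℝ (u p₀.1) y (EuclideanSpace.single 2 1) 2) p₀.2 (EuclideanSpace.single 0 1) *
            fderiv ℝ (u p₀.1) p₀.2 (EuclideanSpace.single 1 1) 2 -
          fderiv ℝ (fun y => fderiv ℝ (u p₀.1) y (EuclideanSpace.single 2 1) 2) p₀.2 (EuclideanSpace.single 1 1) *
            fderiv ℝ (u p₀.1) p₀.2 (EuclideanSpace.single 0 1) 2 ≠ 0 →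
      μ p₀.1 (p₀.2 2) ≠ 0 → μ p₀.1 (p₀.2 2) ≠ 1 → deriv (μ p₀.1) (p₀.2 2) ≠ 0 →
      μ p₀.1 (p₀.2 2) < 0 →
      (fderiv ℝ (u p₀.1) p₀.2 (EuclideanSpace.single 0 1) 0 ≠ fderiv ℝ (u p₀.1) p₀.2 (EuclideanSpace.single 1 1) 1 ∨
        fderiv ℝ (u p₀.1) p₀.2 (EuclideanSpace.single 1 1) 0 ≠ 0) →
      u p₀.1 p₀.2 = 0 →
      fderiv ℝ (u p₀.1) p₀.2 (EuclideanSpace.single 0 1) 2 = 0 →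
      fderiv ℝ (u p₀.1) p₀.2 (EuclideanSpace.single 1 1) 2 = 1 → False := by
  intro u μ A U p₀ hU hp₀ hu hμ hA hpol hdiv hsh hE htw hm0 hm1 hmz _hneg hNU hrest _hx0 _hy1
  exact LocalDatumZ.false_of_gaugedChain items _ steps k e hcheck
    (thSliceLocalDatumZ hU hp₀ hu hμ hA hpol hdiv hsh hE htw hm0 hm1 hmz hNU hrest)

/-- **THE REGISTERED STUB `stub_localTHEmptyHypNUGRS` (VERBATIM) FROM ONE SPLIT-FREE RS-GAUGED CHAIN** (`gaugedChainCheckV`). [folklore] -/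
theorem localTHEmptyHypNUGRS_of_sliceChainZV (items : List ChainItem) (steps : List (List (QMvPoly × ℕ × List ℕ))) (k : ℕ) (e : List ℕ)
    (hcheck : gaugedChainCheckV sliceRelabel.m sliceRelabel.Sf sliceRelabel.Mf sliceRelabel.pins' sliceGaugeZerosRS sliceGaugeValsRS
      sliceRelabel.hyps' items steps k e = true) :
    ∀ (u : ℝ → EuclideanSpace ℝ (Fin 3) → EuclideanSpace ℝ (Fin 3)) (μ A : ℝ → ℝ → ℝ)
      (U : Set (ℝ × EuclideanSpace ℝ (Fin 3))) (p₀ : ℝ × EuclideanSpace ℝ (Fin 3)),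
      IsOpen U → p₀ ∈ U →
      AnalyticOnNhd ℝ (Function.uncurry u) U →
      (∀ p ∈ U, AnalyticAt ℝ (Function.uncurry μ) (p.1, p.2 2)) →
      (∀ p ∈ U, AnalyticAt ℝ (Function.uncurry A) (p.1, p.2 2)) →
      (∀ p ∈ U, fderiv ℝ (u p.1) p.2 (EuclideanSpace.single 0 1) 1 = fderiv ℝ (u p.1) p.2 (EuclideanSpace.single 1 1) 0) →
      (∀ p ∈ U, fderiv ℝ (u p.1) p.2 (EuclideanSpace.single 0 1) 0 + fderiv ℝ (u p.1) p.2 (EuclideanSpace.single 1 1) 1 +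
        fderiv ℝ (u p.1) p.2 (EuclideanSpace.single 2 1) 2 = 0) →
      (∀ p ∈ U, ∀ b : Fin 3, b ≠ 2 →
        fderiv ℝ (u p.1) p.2 (EuclideanSpace.single 2 1) b =
          μ p.1 (p.2 2) * fderiv ℝ (u p.1) p.2 (EuclideanSpace.single b 1) 2) →
      (∀ p ∈ U,
        (1 - μ p.1 (p.2 2)) *
            (deriv (fun s => u s p.2 2) p.1 + fderiv ℝ (fun y => u p.1 y 2) p.2 (u p.1 p.2)
              - Δ (fun y => u p.1 y 2) p.2) =
          A p.1 (p.2 2) + (deriv (fun s => μ s (p.2 2)) p.1 - deriv (deriv (μ p.1)) (p.2 2)) * u p.1 p.2 2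
            + deriv (μ p.1) (p.2 2) / 2 * u p.1 p.2 2 ^ 2
            - 2 * deriv (μ p.1) (p.2 2) * fderiv ℝ (u p.1) p.2 (EuclideanSpace.single 2 1) 2) →
      fderiv ℝ (fun y => fderiv ℝ (u p₀.1) y (EuclideanSpace.single 2 1) 2) p₀.2 (EuclideanSpace.single 0 1) *
            fderiv ℝ (u p₀.1) p₀.2 (EuclideanSpace.single 1 1) 2 -
          fderiv ℝ (fun y => fderiv ℝ (u p₀.1) y (EuclideanSpace.single 2 1) 2) p₀.2 (EuclideanSpace.single 1 1) *
            fderiv ℝ (u p₀.1) p₀.2 (EuclideanSpace.single 0 1) 2 ≠ 0 →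
      μ p₀.1 (p₀.2 2) ≠ 0 → μ p₀.1 (p₀.2 2) ≠ 1 → deriv (μ p₀.1) (p₀.2 2) ≠ 0 →
      μ p₀.1 (p₀.2 2) < 0 →
      (fderiv ℝ (u p₀.1) p₀.2 (EuclideanSpace.single 0 1) 0 ≠ fderiv ℝ (u p₀.1) p₀.2 (EuclideanSpace.single 1 1) 1 ∨
        fderiv ℝ (u p₀.1) p₀.2 (EuclideanSpace.single 1 1) 0 ≠ 0) →
      u p₀.1 p₀.2 = 0 →
      fderiv ℝ (u p₀.1) p₀.2 (EuclideanSpace.single 0 1) 2 = 0 →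
      fderiv ℝ (u p₀.1) p₀.2 (EuclideanSpace.single 1 1) 2 = 1 → False := by
  intro u μ A U p₀ hU hp₀ hu hμ hA hpol hdiv hsh hE htw hm0 hm1 hmz _hneg hNU hrest hx0 hy1
  exact LocalDatumZV.false_of_gaugedChain items _ steps k e hcheck
    (thSliceLocalDatumZV hU hp₀ hu hμ hA hpol hdiv hsh hE htw hm0 hm1 hmz hNU hrest hx0 hy1)

end Summit.NavierStokesRegularity.NavierStokesRegularity.Theorems.PoloidalWindowDoorLrcModEntireTHCertSliceGaugeUD8T

end
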